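import Mathlib
import Literature.MathematicalPhysics.QuantumFieldTheory.Balaban1983to89.Beta.WindowIdentification

/-!
# Road «FP» (binder row D1), N7 — the `hrep` ASSEMBLY socket: base-point currency (REP-F) + window LEGS + shell TAILS ⟹ `hrep`

leaf-02-g3's REP∞ chain of record ends in the BASE-POINT CURRENCY (`FP/PerfectRepBasePoint.secondMoment_TPerfOf_perfect_eq_basePoint`):
  `g = Σ_{b ∈ Bset} wt b · fullSum (Φ b)`,  `Φ b w = n⁻⁸ · w_μ w_ν · (fine kernel at base point b, offset w)`,
with `WindowIdentification.fullSum` (punctured lattice sum as the limit of `psum`).  Road FP's N7 END (`FP/AsymptoticEndAvg.hasym_of_legInterface_avg`)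
wants `hrep`: `|g − c₀ − Σ_b wt b · Σ_{w ∈ annulus 4 0 R₀} w_μ w_ν Σ_i cc₀ i · F′ b i w · G′ b i w| ≤ U`.
THIS FILE types the two analytic rows in between and assembles them (pure bookkeeping, [folklore]):
* LEGS (window): per base point, `|psum (Φ b) R₀ − Σ_{w ∈ annulus 4 0 R₀} w_μ w_ν Σ_i cc₀ i F′ b i w G′ b i w| ≤ U₁` — the Taylor-paired table part of
  the fine kernel, the contact/remainder terms being `U₁` (`REP-DESIGN.md` (P3));
* TAILS (shells): per base point, the shellwise bound `|Φ b w| ≤ E/(r+1)⁴ · e^{−(δ/Lr)(r+1)}` on `annulus 4 r (r+1)`, `r ≥ M` — then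
  `WindowIdentification.abs_fullSum_sub_psum_le` BY NAME gives `|fullSum (Φ b) − psum (Φ b) R₀| ≤ 80E(1+Lr/δ)/(R₀+1)`;
* **`hrep_of_basePoint`**: with convex weights, `|g − Σ_b wt b · (window leg bilinear)| ≤ U₁ + 80E(1+Lr/δ)/(R₀+1)` (so `c₀ = 0`).
Nothing about Bałaban's objects is asserted; `Φ`, `F′`, `G′`, the table and the constants are free.
HONEST FRAMING: bookkeeping toward `hident` (GAPS O-asym1-7); discharges nothing of `BetaPertH`; NOT the continuum limit, NOT Clay.
-/

noncomputable section

open Finset Filter Topology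
open scoped BigOperators

namespace Summit.QuantumFields.BalabanUV.Beta.FP.RepAssembly

open Literature.Probability.LatticeModels (annulus)
open Literature.MathematicalPhysics.QuantumFieldTheory.Balaban1983to89.Beta
open Literature.MathematicalPhysics.QuantumFieldTheory.Balaban1983to89.Beta.DyadicShell (Pt toReal supNorm)
open Literature.MathematicalPhysics.QuantumFieldTheory.Balaban1983to89.Beta.WindowIdentification (psum fullSum abs_fullSum_sub_psum_le)

/-- [folklore] **Convex combinations preserve uniform bounds**: `|Σ_b wt b · x b| ≤ U` if `0 ≤ wt`, `Σ wt = 1`, `|x b| ≤ U`. -/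
theorem abs_sum_wt_mul_le {κB : Type*} {Bset : Finset κB} {wt x : κB → ℝ} {U : ℝ}
    (hwt0 : ∀ b ∈ Bset, 0 ≤ wt b) (hwt1 : ∑ b ∈ Bset, wt b = 1) (hx : ∀ b ∈ Bset, |x b| ≤ U) :
    |∑ b ∈ Bset, wt b * x b| ≤ U := by
  calc |∑ b ∈ Bset, wt b * x b| ≤ ∑ b ∈ Bset, |wt b * x b| := abs_sum_le_sum_abs _ _
    _ ≤ ∑ b ∈ Bset, wt b * U := by
        refine sum_le_sum fun b hb => ?_
        rw [abs_mul, abs_of_nonneg (hwt0 b hb)]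
        exact mul_le_mul_of_nonneg_left (hx b hb) (hwt0 b hb)
    _ = U := by rw [← sum_mul, hwt1, one_mul]

section Assembly

variable {κB ι : Type*} {Bset : Finset κB} {wt : κB → ℝ} {Φ : κB → Pt → ℝ} {s : Finset ι} {cc₀ : ι → ℝ}
  {F' G' : κB → ι → Pt → ℝ} {μ ν : Fin 4}

/-- [folklore] **THE `hrep` ASSEMBLY at one blocking.**  Base-point currency `g = Σ_b wt b · fullSum (Φ b)`, window LEGS bound `U₁` and
shellwise TAILS beyond `M ≤ R₀` give `|g − Σ_b wt b · Σ_{w ∈ annulus 4 0 R₀} w_μ w_ν Σ_i cc₀ i F′ b i w G′ b i w| ≤ U₁ + 80E(1+Lr/δ)/(R₀+1)`. -/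
theorem hrep_of_basePoint {g : ℝ} (hg : g = ∑ b ∈ Bset, wt b * fullSum (Φ b))
    (hwt0 : ∀ b ∈ Bset, 0 ≤ wt b) (hwt1 : ∑ b ∈ Bset, wt b = 1) {R₀ M : ℕ} (hMR : M ≤ R₀) {U₁ E δ Lr : ℝ}
    (hE : 0 ≤ E) (hδ : 0 < δ) (hL : 0 < Lr)
    (hlegs : ∀ b ∈ Bset, |psum (Φ b) R₀
        - ∑ w ∈ annulus 4 0 R₀, toReal w μ * toReal w ν * ∑ i ∈ s, cc₀ i * (F' b i w * G' b i w)| ≤ U₁)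
    (htail : ∀ b ∈ Bset, ∀ r : ℕ, M ≤ r → ∀ w ∈ annulus 4 r (r + 1),
        |Φ b w| ≤ E / ((r : ℝ) + 1) ^ 4 * Real.exp (-(δ / Lr) * ((r : ℝ) + 1))) :
    |g - ∑ b ∈ Bset, wt b * ∑ w ∈ annulus 4 0 R₀, toReal w μ * toReal w ν * ∑ i ∈ s, cc₀ i * (F' b i w * G' b i w)|
      ≤ U₁ + 80 * E * (1 + Lr / δ) / ((R₀ : ℝ) + 1) := by
  rw [hg, ← sum_sub_distrib]
  have e : ∀ b ∈ Bset, wt b * fullSum (Φ b)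
      - wt b * ∑ w ∈ annulus 4 0 R₀, toReal w μ * toReal w ν * ∑ i ∈ s, cc₀ i * (F' b i w * G' b i w)
      = wt b * ((fullSum (Φ b) - psum (Φ b) R₀)
          + (psum (Φ b) R₀ - ∑ w ∈ annulus 4 0 R₀, toReal w μ * toReal w ν * ∑ i ∈ s, cc₀ i * (F' b i w * G' b i w))) :=
    fun b _ => by ring
  rw [sum_congr rfl e]
  refine abs_sum_wt_mul_le hwt0 hwt1 fun b hb => ?_
  have h1 := abs_fullSum_sub_psum_le hE hδ hL (htail b hb) hMR
  have h2 := hlegs b hb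
  calc |fullSum (Φ b) - psum (Φ b) R₀
        + (psum (Φ b) R₀ - ∑ w ∈ annulus 4 0 R₀, toReal w μ * toReal w ν * ∑ i ∈ s, cc₀ i * (F' b i w * G' b i w))|
      ≤ |fullSum (Φ b) - psum (Φ b) R₀|
        + |psum (Φ b) R₀ - ∑ w ∈ annulus 4 0 R₀, toReal w μ * toReal w ν * ∑ i ∈ s, cc₀ i * (F' b i w * G' b i w)| :=
        abs_add_le _ _
    _ ≤ 80 * E * (1 + Lr / δ) / ((R₀ : ℝ) + 1) + U₁ := add_le_add h1 h2
    _ = U₁ + 80 * E * (1 + Lr / δ) / ((R₀ : ℝ) + 1) := add_comm _ _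

/-- [folklore] **… uniformly in the window radius**: since `80E(1+Lr/δ)/(R₀+1) ≤ 80E(1+Lr/δ)`, the bound `U := U₁ + 80E(1+Lr/δ)` is `R₀`-free —
the shape of the `hrep` binder of `FP/AsymptoticEndAvg.hasym_of_legInterface_avg` (with `c₀ = 0`, per blocking `n = Lc^m`, `R₀ := max (M n) …`). -/
theorem hrep_of_basePoint_uniform {g : ℝ} (hg : g = ∑ b ∈ Bset, wt b * fullSum (Φ b))
    (hwt0 : ∀ b ∈ Bset, 0 ≤ wt b) (hwt1 : ∑ b ∈ Bset, wt b = 1) {R₀ M : ℕ} (hMR : M ≤ R₀) {U₁ E δ Lr : ℝ}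
    (hE : 0 ≤ E) (hδ : 0 < δ) (hL : 0 < Lr)
    (hlegs : ∀ b ∈ Bset, |psum (Φ b) R₀
        - ∑ w ∈ annulus 4 0 R₀, toReal w μ * toReal w ν * ∑ i ∈ s, cc₀ i * (F' b i w * G' b i w)| ≤ U₁)
    (htail : ∀ b ∈ Bset, ∀ r : ℕ, M ≤ r → ∀ w ∈ annulus 4 r (r + 1),
        |Φ b w| ≤ E / ((r : ℝ) + 1) ^ 4 * Real.exp (-(δ / Lr) * ((r : ℝ) + 1))) :
    |g - 0 - ∑ b ∈ Bset, wt b * ∑ w ∈ annulus 4 0 R₀, toReal w μ * toReal w ν * ∑ i ∈ s, cc₀ i * (F' b i w * G' b i w)|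
      ≤ U₁ + 80 * E * (1 + Lr / δ) := by
  rw [sub_zero]
  refine (hrep_of_basePoint hg hwt0 hwt1 hMR hE hδ hL hlegs htail).trans ?_
  have hT : 0 ≤ 80 * E * (1 + Lr / δ) := by positivity
  have hR : (1 : ℝ) ≤ (R₀ : ℝ) + 1 := by
    have : (0 : ℝ) ≤ (R₀ : ℝ) := Nat.cast_nonneg _
    linarith
  have : 80 * E * (1 + Lr / δ) / ((R₀ : ℝ) + 1) ≤ 80 * E * (1 + Lr / δ) := div_le_self hT hR
  linarith

end Assembly

/-! ## v1.1 — the m-UNIFORM form: tail scale `Lr := n` and window radius `R₀ + 1 ≥ n` give an `n`-free bound -/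

section Uniform

variable {κB ι : Type*} {Bset : Finset κB} {wt : κB → ℝ} {Φ : κB → Pt → ℝ} {s : Finset ι} {cc₀ : ι → ℝ}
  {F' G' : κB → ι → Pt → ℝ} {μ ν : Fin 4}

/-- [folklore] **THE `hrep` ASSEMBLY, `n`-UNIFORM BOUND.**  With the tail scale equal to the blocking (`Lr := n`, the END's `e^{−(δ/n)(r+1)}`) and a
window radius `R₀` with `n ≤ R₀ + 1`, the tail contribution `80E(1 + n/δ)/(R₀+1)` is at most `80E(1 + 1/δ)` — so
`|g − 0 − Σ_b wt b · (window leg bilinear)| ≤ U₁ + 80E(1 + 1/δ)` with an `n`-FREE right-hand side (given `n`-free `U₁`, `E`, `δ`), which is what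
the `∀ m` binder `hrep` of `FP/AsymptoticEndAvg.hasym_of_legInterface_avg` needs (`R₀ := max (M (Lc^m)) (Lc^m)` per `m`). -/
theorem hrep_of_basePoint_nUniform {g : ℝ} (hg : g = ∑ b ∈ Bset, wt b * fullSum (Φ b))
    (hwt0 : ∀ b ∈ Bset, 0 ≤ wt b) (hwt1 : ∑ b ∈ Bset, wt b = 1) {R₀ M n : ℕ} (hMR : M ≤ R₀) (hn : 1 ≤ n) (hnR : n ≤ R₀ + 1)
    {U₁ E δ : ℝ} (hE : 0 ≤ E) (hδ : 0 < δ)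
    (hlegs : ∀ b ∈ Bset, |psum (Φ b) R₀
        - ∑ w ∈ annulus 4 0 R₀, toReal w μ * toReal w ν * ∑ i ∈ s, cc₀ i * (F' b i w * G' b i w)| ≤ U₁)
    (htail : ∀ b ∈ Bset, ∀ r : ℕ, M ≤ r → ∀ w ∈ annulus 4 r (r + 1),
        |Φ b w| ≤ E / ((r : ℝ) + 1) ^ 4 * Real.exp (-(δ / (n : ℝ)) * ((r : ℝ) + 1))) :
    |g - 0 - ∑ b ∈ Bset, wt b * ∑ w ∈ annulus 4 0 R₀, toReal w μ * toReal w ν * ∑ i ∈ s, cc₀ i * (F' b i w * G' b i w)|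
      ≤ U₁ + 80 * E * (1 + 1 / δ) := by
  have hn' : (0 : ℝ) < (n : ℝ) := by exact_mod_cast hn
  rw [sub_zero]
  refine (hrep_of_basePoint hg hwt0 hwt1 hMR hE hδ hn' hlegs htail).trans ?_
  -- `80E(1 + n/δ)/(R₀+1) ≤ 80E(1 + 1/δ)` from `n ≤ R₀ + 1`
  have hR : (0 : ℝ) < (R₀ : ℝ) + 1 := by positivity
  have hnR' : (n : ℝ) ≤ (R₀ : ℝ) + 1 := by exact_mod_cast hnR
  have hkey : (1 + (n : ℝ) / δ) / ((R₀ : ℝ) + 1) ≤ 1 + 1 / δ := by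
    rw [div_le_iff₀ hR]
    have h1 : (1 : ℝ) ≤ (R₀ : ℝ) + 1 := by linarith [hn'.le, hnR']
    have h2 : (n : ℝ) / δ ≤ 1 / δ * ((R₀ : ℝ) + 1) := by
      rw [one_div_mul_eq_div]
      exact div_le_div_of_nonneg_right hnR' hδ.le
    nlinarith [h1, h2, div_nonneg hn'.le hδ.le]
  have hT : 0 ≤ 80 * E := by positivity
  calc U₁ + 80 * E * (1 + (n : ℝ) / δ) / ((R₀ : ℝ) + 1)
      = U₁ + 80 * E * ((1 + (n : ℝ) / δ) / ((R₀ : ℝ) + 1)) := by ring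
    _ ≤ U₁ + 80 * E * (1 + 1 / δ) := by nlinarith [mul_le_mul_of_nonneg_left hkey hT]

end Uniform

end Summit.QuantumFields.BalabanUV.Beta.FP.RepAssembly

end
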